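import Summits.QuantumFields.YangMills.Theorems.AlphaInputsT3ACv3CovLinAvgFrame
import Literature.MathematicalPhysics.QuantumFieldTheory.Balaban1983to89.B12Average05And08
import Literature.MathematicalPhysics.QuantumFieldTheory.Balaban1983to89.BlockAveragingFederbush
import HarnessLib

/-!
# `AlphaInputsT3ACv3NewtonDefectMap` — STRATEGY B for 2′, the (FL) row under OWNER RULING g24-№4: **THE DEFECT MAP OF THE NEWTON ASSEMBLY** — `Φ(c) = log(Ū^{(k)}(c)·V(c)*)`:
# a vanishing log-defect IS exactness, the defect is gauge-COVARIANT (conjugation at `c₋` by the restricted gauge `u^{(k)}`), and its two-field increment is the increment of the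
# averages up to the tree's second-order log letter — lane `pub-balaban3d` ∕ cell `ym3-torus`, seat `ym-ust-19936-w4` (g0)

WHY (memo `NEWTON-FL-FRAMES-w4-g0.md` §1; ★w1 memo v2.1 row R6).  The shell `…v3NewtonShell.exists_zero_in_range_of_approxRightInverse` is applied to
`Φ(a)(c) := mlog(avg^k(e^{a}U₀)(c)·V(c)*)` on the coarse bonds of the region.  Three facts wire its output and hypotheses to the lattice:
* §1 ★ `eq_of_mlog_mul_star_eq_zero` — `‖WV* − 1‖ < 1`, `mlog(WV*) = 0 ⟹ W = V` (`MatrixLog.exp_mlog`): the zero of `Φ` IS the exactness `Ū^{(k)} = V` of `top42Set`∕`hLift` (`iter_eq_of_defect_zero`);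
  `mlog_mul_star_self` (the converse).
* §2 ★ `defect_gaugeAct` — for a finest gauge `u` and its restriction `u^{(k)} = transfUp u k` along the block centres: `avg^k(U^u)(c)·(V^{u^{(k)}}(c))* = u^{(k)}(c₋)·[avg^k U(c)·V(c)*]·u^{(k)}(c₋)*`
  (`T4Continuum.iter_gaugeAct` + `CovLinAvgFrame.coe_gaugeAct`), and ★ `mlog_defect_gaugeAct` — the log-defect is conjugated likewise (`B12Average05And08.mlog_conj_units`): the assembly may
  compute `Φ` per coarse bond in ANY stencil gauge and rotate back.
* §3 `norm_defect_sub_defect_eq` (`‖W₁V* − W₂V*‖ = ‖W₁ − W₂‖`) and ★ `norm_mlog_defect_sub_sub_le` — `‖Φ₁ − Φ₂ − (W₁ − W₂)V*‖ ≤ ρ∕(1−ρ)·‖W₁ − W₂‖` when both defects are ρ-close to `1`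
  (`FederbushMean.norm_mlog_sub_mlog_sub_le`): hypothesis (i) of the shell reduces to ★w1's two-field derivative row R3 on the averages.
Count-neutral helper toward R3 2′ (items 19936∕19935); `hLift`∕(FL) NOT proved here; registry untouched; nothing about d = 4, the continuum, or a mass gap; YM₃ on T³ is rung R3, not Clay.

References: T. Bałaban, Commun. Math. Phys. 98 (1985) 17–51 [Balaban1985Averaging] ((11)–(13) p.19, (20)–(23) p.21); CMP 102 (1985) 277–309 [Balaban1985Variational] ((4) p.278, (8) p.279).
-/

set_option autoImplicit false

noncomputable section

open scoped Matrix.Norms.L2Operator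
open NormedSpace

namespace Summit.QuantumFields.YangMills.Theorems.NewtonDefectMap

open Literature.MathematicalPhysics.QuantumFieldTheory.Balaban1983to89
open Literature.MathematicalPhysics.QuantumFieldTheory.Balaban1983to89.MatrixLog (mlog exp_mlog mlog_one norm_mlog_le_two_mul norm_sub_one_le_two_mul_norm_mlog)
open T4Continuum
open Summit.QuantumFields.YangMills.Theorems.CovLinAvgFrame (coe_gaugeAct)
open Summit.QuantumFields.YangMills.Theorems.Prop7HolRatioPerStep (coe_star_mul_self coe_mul_star_self)

variable {n : Type*} [Fintype n] [DecidableEq n] {P : Params}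

/-! ## §1 A vanishing log-defect is exactness -/

omit [DecidableEq n] in
/-- **★ EXACTNESS FROM A VANISHING LOG-DEFECT**: for `W, V ∈ SU(n)` with `‖WV* − 1‖ < 1` and `log(WV*) = 0`, `W = V` (`WV* = e^{log(WV*)} = e^0 = 1`). [cite: Balaban1985Averaging, (20)–(21) p.21] -/
theorem eq_of_mlog_mul_star_eq_zero [DecidableEq n] (W V : Matrix.specialUnitaryGroup n ℂ) (h1 : ‖(W : Matrix n n ℂ) * star (V : Matrix n n ℂ) - 1‖ < 1)
    (h0 : mlog ((W : Matrix n n ℂ) * star (V : Matrix n n ℂ)) = 0) : W = V := by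
  have hX : (W : Matrix n n ℂ) * star (V : Matrix n n ℂ) = 1 := by
    rw [← exp_mlog h1, h0, exp_zero]
  apply Subtype.ext
  calc (W : Matrix n n ℂ) = (W : Matrix n n ℂ) * (star (V : Matrix n n ℂ) * (V : Matrix n n ℂ)) := by rw [coe_star_mul_self, mul_one]
    _ = ((W : Matrix n n ℂ) * star (V : Matrix n n ℂ)) * (V : Matrix n n ℂ) := by rw [mul_assoc]
    _ = (V : Matrix n n ℂ) := by rw [hX, one_mul]

/-- The converse: an exact bond has zero log-defect (`log 1 = 0`). [cite: Balaban1985Averaging, (21) p.21] -/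
theorem mlog_mul_star_self (V : Matrix.specialUnitaryGroup n ℂ) : mlog ((V : Matrix n n ℂ) * star (V : Matrix n n ℂ)) = 0 := by
  rw [coe_mul_star_self, mlog_one]

variable [Nonempty n]

/-- **EXACTNESS OF THE `k`-FOLD AVERAGE ON A SET OF COARSE BONDS FROM THE ZERO OF THE DEFECT MAP** (the form `top42Set`∕`hLift` consume): if at every `c ∈ S` the defect `Ū(c)V(c)*` is within `1`
of the identity and has zero logarithm, then `Ū = V` on `S`. [cite: Balaban1985Variational, (8) p.279; Balaban1985UV3, (42) p.266] -/
theorem iter_eq_of_defect_zero (av : ∀ j, Averaging P j (Matrix.specialUnitaryGroup n ℂ)) (k : ℕ) (U : GaugeField P 0 (Matrix.specialUnitaryGroup n ℂ))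
    (V : GaugeField P k (Matrix.specialUnitaryGroup n ℂ)) (S : Set (PBond P k))
    (h1 : ∀ c ∈ S, ‖((Averaging.iter av k U c : Matrix.specialUnitaryGroup n ℂ) : Matrix n n ℂ) * star (V c : Matrix n n ℂ) - 1‖ < 1)
    (h0 : ∀ c ∈ S, mlog (((Averaging.iter av k U c : Matrix.specialUnitaryGroup n ℂ) : Matrix n n ℂ) * star (V c : Matrix n n ℂ)) = 0) :
    ∀ c ∈ S, Averaging.iter av k U c = V c :=
  fun c hc => eq_of_mlog_mul_star_eq_zero _ _ (h1 c hc) (h0 c hc)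

/-! ## §2 Gauge covariance of the defect -/

/-- **★ THE DEFECT IS GAUGE-COVARIANT**: for a finest gauge `u` with restriction `u^{(k)} = transfUp u k` (the gauge «coinciding with `u` at points of the new lattice»),
`avg^k(U^u)(c)·(V^{u^{(k)}}(c))* = u^{(k)}(c₋)·[avg^k U(c)·V(c)*]·u^{(k)}(c₋)*` (standing range `k ≤ m + K`). [cite: Balaban1985Averaging, (11)–(13) p.19] -/
theorem defect_gaugeAct (av : ∀ j, Averaging P j (Matrix.specialUnitaryGroup n ℂ)) (u : GaugeTransf P 0 (Matrix.specialUnitaryGroup n ℂ)) {k : ℕ} (hk : k ≤ P.m + P.K)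
    (U : GaugeField P 0 (Matrix.specialUnitaryGroup n ℂ)) (V : GaugeField P k (Matrix.specialUnitaryGroup n ℂ)) (c : PBond P k) :
    ((Averaging.iter av k (GaugeField.gaugeAct u U) c : Matrix.specialUnitaryGroup n ℂ) : Matrix n n ℂ) *
        star ((GaugeField.gaugeAct (transfUp u k) V c : Matrix.specialUnitaryGroup n ℂ) : Matrix n n ℂ) =
      (transfUp u k c.src : Matrix n n ℂ) * (((Averaging.iter av k U c : Matrix.specialUnitaryGroup n ℂ) : Matrix n n ℂ) * star (V c : Matrix n n ℂ)) *
        star (transfUp u k c.src : Matrix n n ℂ) := by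
  rw [iter_gaugeAct av u k hk U, coe_gaugeAct, coe_gaugeAct]
  simp only [star_mul, star_star]
  set h₀ := (transfUp u k c.src : Matrix n n ℂ)
  set h₁ := (transfUp u k c.tgt : Matrix n n ℂ)
  set W := ((Averaging.iter av k U c : Matrix.specialUnitaryGroup n ℂ) : Matrix n n ℂ)
  calc h₀ * W * star h₁ * (h₁ * (star (V c : Matrix n n ℂ) * star h₀)) = h₀ * W * (star h₁ * h₁) * star (V c : Matrix n n ℂ) * star h₀ := by noncomm_ring
    _ = h₀ * (W * star (V c : Matrix n n ℂ)) * star h₀ := by rw [coe_star_mul_self]; noncomm_ring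

omit [Nonempty n] in
/-- `log(g X g*) = g·log X·g*` for `g ∈ SU(n)`, `‖X − 1‖ < 1` (termwise conjugation of the series; `B12Average05And08.mlog_conj_units`). [cite: Balaban1985Averaging, (21)–(23) p.21] -/
theorem mlog_conj_SU (g : Matrix.specialUnitaryGroup n ℂ) {X : Matrix n n ℂ} (hX : ‖X - 1‖ < 1) :
    mlog ((g : Matrix n n ℂ) * X * star (g : Matrix n n ℂ)) = (g : Matrix n n ℂ) * mlog X * star (g : Matrix n n ℂ) := by
  set Pu : (Matrix n n ℂ)ˣ := ⟨(g : Matrix n n ℂ), star (g : Matrix n n ℂ), coe_mul_star_self g, coe_star_mul_self g⟩ with hPu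
  have hP : ((Pu : (Matrix n n ℂ)ˣ) : Matrix n n ℂ) = (g : Matrix n n ℂ) := rfl
  have hPi : ((Pu⁻¹ : (Matrix n n ℂ)ˣ) : Matrix n n ℂ) = star (g : Matrix n n ℂ) := rfl
  have hPZ : ‖(Pu : Matrix n n ℂ) * X * ((Pu⁻¹ : (Matrix n n ℂ)ˣ) : Matrix n n ℂ) - 1‖ < 1 := by
    rw [hP, hPi]
    have e : (g : Matrix n n ℂ) * X * star (g : Matrix n n ℂ) - 1 = (g : Matrix n n ℂ) * (X - 1) * star (g : Matrix n n ℂ) := by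
      rw [mul_sub, sub_mul, mul_one, coe_mul_star_self]
    rw [e, PerturbedPlaquette.norm_conj_SU]; exact hX
  have := B12Average05And08.mlog_conj_units (P := Pu) hX hPZ
  rwa [hP, hPi] at this

/-- **★ THE LOG-DEFECT IS GAUGE-COVARIANT**: `log(avg^k(U^u)(c)·V^{u^{(k)}}(c)*) = u^{(k)}(c₋)·log(avg^k U(c)·V(c)*)·u^{(k)}(c₋)*` when the defect is within `1` of the identity — the Newton
defect map may be evaluated per coarse bond in any stencil gauge and rotated back. [cite: Balaban1985Averaging, (11)–(13) p.19, (21)–(23) p.21] -/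
theorem mlog_defect_gaugeAct (av : ∀ j, Averaging P j (Matrix.specialUnitaryGroup n ℂ)) (u : GaugeTransf P 0 (Matrix.specialUnitaryGroup n ℂ)) {k : ℕ} (hk : k ≤ P.m + P.K)
    (U : GaugeField P 0 (Matrix.specialUnitaryGroup n ℂ)) (V : GaugeField P k (Matrix.specialUnitaryGroup n ℂ)) (c : PBond P k)
    (h1 : ‖((Averaging.iter av k U c : Matrix.specialUnitaryGroup n ℂ) : Matrix n n ℂ) * star (V c : Matrix n n ℂ) - 1‖ < 1) :
    mlog (((Averaging.iter av k (GaugeField.gaugeAct u U) c : Matrix.specialUnitaryGroup n ℂ) : Matrix n n ℂ) *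
        star ((GaugeField.gaugeAct (transfUp u k) V c : Matrix.specialUnitaryGroup n ℂ) : Matrix n n ℂ)) =
      (transfUp u k c.src : Matrix n n ℂ) * mlog (((Averaging.iter av k U c : Matrix.specialUnitaryGroup n ℂ) : Matrix n n ℂ) * star (V c : Matrix n n ℂ)) *
        star (transfUp u k c.src : Matrix n n ℂ) := by
  rw [defect_gaugeAct av u hk U V c, mlog_conj_SU _ h1]

/-- The defect's distance to `1` is gauge invariant. [cite: Balaban1985Averaging, (19) p.21] -/
theorem norm_defect_gaugeAct_sub_one (av : ∀ j, Averaging P j (Matrix.specialUnitaryGroup n ℂ)) (u : GaugeTransf P 0 (Matrix.specialUnitaryGroup n ℂ)) {k : ℕ} (hk : k ≤ P.m + P.K)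
    (U : GaugeField P 0 (Matrix.specialUnitaryGroup n ℂ)) (V : GaugeField P k (Matrix.specialUnitaryGroup n ℂ)) (c : PBond P k) :
    ‖((Averaging.iter av k (GaugeField.gaugeAct u U) c : Matrix.specialUnitaryGroup n ℂ) : Matrix n n ℂ) *
        star ((GaugeField.gaugeAct (transfUp u k) V c : Matrix.specialUnitaryGroup n ℂ) : Matrix n n ℂ) - 1‖ =
      ‖((Averaging.iter av k U c : Matrix.specialUnitaryGroup n ℂ) : Matrix n n ℂ) * star (V c : Matrix n n ℂ) - 1‖ := by
  rw [defect_gaugeAct av u hk U V c]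
  set h₀ := transfUp u k c.src
  have e : (h₀ : Matrix n n ℂ) * (((Averaging.iter av k U c : Matrix.specialUnitaryGroup n ℂ) : Matrix n n ℂ) * star (V c : Matrix n n ℂ)) * star (h₀ : Matrix n n ℂ) - 1 =
      (h₀ : Matrix n n ℂ) * (((Averaging.iter av k U c : Matrix.specialUnitaryGroup n ℂ) : Matrix n n ℂ) * star (V c : Matrix n n ℂ) - 1) * star (h₀ : Matrix n n ℂ) := by
    rw [mul_sub, sub_mul, mul_one, coe_mul_star_self]
  rw [e, PerturbedPlaquette.norm_conj_SU]

/-! ## §3 The two-field increment of the log-defect -/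

omit [Nonempty n] in
/-- `‖W₁V* − W₂V*‖ = ‖W₁ − W₂‖` for `V ∈ SU(n)`. [folklore] -/
theorem norm_defect_sub_defect_eq (W₁ W₂ : Matrix n n ℂ) (V : Matrix.specialUnitaryGroup n ℂ) :
    ‖W₁ * star (V : Matrix n n ℂ) - W₂ * star (V : Matrix n n ℂ)‖ = ‖W₁ - W₂‖ := by
  rw [← sub_mul, CStarRing.norm_mul_mem_unitary _ (Unitary.star_mem V.2.1)]

omit [Nonempty n] in
/-- **★ THE TWO-FIELD INCREMENT OF THE LOG-DEFECT IS THE INCREMENT OF THE AVERAGES, TO SECOND ORDER**: if both defects `WᵢV*` are ρ-close to `1` (`ρ < 1`), then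
`‖log(W₁V*) − log(W₂V*) − (W₁ − W₂)V*‖ ≤ ρ∕(1−ρ)·‖W₁ − W₂‖` (`FederbushMean.norm_mlog_sub_mlog_sub_le`) — so hypothesis (i) of the Newton shell for `Φ = log(Ū^{(k)}V*)` is ★w1's two-field
derivative row on `Ū₁^{(k)} − Ū₂^{(k)}` (`…EMLTwoFieldIterUniform`) plus this letter. [cite: Balaban1985Averaging, (20)–(23) p.21] -/
theorem norm_mlog_defect_sub_sub_le (W₁ W₂ : Matrix n n ℂ) (V : Matrix.specialUnitaryGroup n ℂ) {ρ : ℝ} (hρ : ρ < 1)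
    (h₁ : ‖W₁ * star (V : Matrix n n ℂ) - 1‖ ≤ ρ) (h₂ : ‖W₂ * star (V : Matrix n n ℂ) - 1‖ ≤ ρ) :
    ‖mlog (W₁ * star (V : Matrix n n ℂ)) - mlog (W₂ * star (V : Matrix n n ℂ)) - (W₁ - W₂) * star (V : Matrix n n ℂ)‖ ≤ ρ / (1 - ρ) * ‖W₁ - W₂‖ := by
  have h := FederbushMean.norm_mlog_sub_mlog_sub_le hρ h₁ h₂
  rw [norm_defect_sub_defect_eq, ← sub_mul] at h
  exact h

omit [Nonempty n] in
/-- **THE LOG-DEFECT AND THE DISTANCE TO EXACTNESS ARE EQUIVALENT SIZES** near the identity: `‖log(WV*)‖ ≤ 2‖WV* − 1‖` and `‖WV* − 1‖ ≤ 2‖log(WV*)‖` for `‖WV* − 1‖ ≤ 1/2`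
(`MatrixLog.norm_mlog_le_two_mul`, `norm_sub_one_le_two_mul_norm_mlog`). [cite: Balaban1985Averaging, (20)–(21) p.21] -/
theorem norm_mlog_defect_le_and_ge (X : Matrix n n ℂ) (hX : ‖X - 1‖ ≤ 1 / 2) : ‖mlog X‖ ≤ 2 * ‖X - 1‖ ∧ ‖X - 1‖ ≤ 2 * ‖mlog X‖ :=
  ⟨norm_mlog_le_two_mul hX, norm_sub_one_le_two_mul_norm_mlog hX⟩

end Summit.QuantumFields.YangMills.Theorems.NewtonDefectMap

end
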